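import Summits.AnomalousDissipation.AnomalousDissipation.Theorems.SawtoothPulseCascadeK2ConeGauge
import Summits.AnomalousDissipation.AnomalousDissipation.Theorems.SawtoothPulseCascadeK2InjectionCap5
import Summits.AnomalousDissipation.AnomalousDissipation.Theorems.SawtoothPulseCascadeK3LocalisedClosurePointGlueP

/-!
# K2 — S4 vet (planner ad-ideate-p4 g18 «control», F-p4g18-1, arbiter A26-8 (a)(b)): the RESHAPED material representation
# `MatRepAt′`, the matching cone-with-profile `ConeP`, budget `BudgetP`, and the assembly RE-PROVED through them

Companion of `K2AssemblyS4-vet-p4g18.md` (same crux dir, stmt-AnomalousDissipation-19491).  What changes w.r.t. p3 g8's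
`K2AssemblyS4.lean` v3 (e6aea1eb341d) §3 `MatRepAt` — see the memo for the reasons (findings F1–F6):

* the ADMISSIBILITY predicate of the entry families is ABSTRACTED (`Adm M D`; v4 instantiates it with the window-corrected
  `EntryBoundsW 8 K₀`, memo F1) — the assembly below does not depend on the lattice definitions at all;
* generations are NOT finitely supported (memo F2): `x : ℕ → Idx → ℝ`, `0 ≤ x n i` for all `n`; (R1)/(R2) are stated against every real `c`
  bounding ALL finite partial sums (tsum-free, junk-free);
* (R1η) carries a per-phase slack `(1 + η)` (memo F3) and the COMB-LINEAGE FEED `ι (n+1) i · √E₀` at every age (memo F4; `ι 0` = injection);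
* (R2′) reads out every older generation through age-graded DEBRIS weights `Pd k i` (`Pd 0` = the entering generation itself) and the comb
  remnant lineage `cR n · √E₀` (memo F5);
* the cone-with-profile `ConeP` carries, besides p4's renewal cone clause VERBATIM (finite column sets, partial age sums, `ρ^{-(k+1)}` discount),
  the profile costs `ι n ≤ κ n • ε`, `Σ_{i∈S} Pd k i ε i ≤ ϖ k`, the discounted product `(Σ_{m≤n} κ m ρ^{-m})(Σ_{k≤n} ϖ k ρ^{-k}) ≤ Γ` and
  `0 ≤ cR n ≤ Cc ρ^n`; the budget is `(1+η)ρ ≤ 5e^{8σ⋆}`, `B Γ + Cc ≤ (5e^{8σ⋆})²`.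

PROVED: `GenBook.readout_le` (the algebraic core: bookkeeping + cone + budget ⇒ `E(t) ≤ (5e^{8σ⋆})^{2(n+2)} E₀`),
`k2PhaseGrowthClassicalH_of_matRep'`, `K2GrowthCtgPointH_of'`, `target_of_S4'`.  No sorry.  Nothing numerical is asserted.
-/

set_option linter.dupNamespace false
set_option linter.unusedVariables false

noncomputable section

namespace Summit.AnomalousDissipation.AnomalousDissipation.Cruxes.K1LocalisedCascade.K2S4Vet

open MeasureTheory
open Literature.Analysis Literature.Analysis.FunctionSpaces Literature.Analysis.FluidPDE
open Literature.Analysis.FluidPDE.SawtoothCascade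

/-! ## 1. Abstract generation bookkeeping at one read-out time -/

section Algebra

variable {Idx : Type*}

/-- **GENERATION BOOKKEEPING** (the algebraic content of `MatRepAt′` at one time `t` of phase `j₀+1+n`, input energy `E₀`, energy `Et` at `t`):
generation amplitudes `x m i ≥ 0` with (R0) `x 0 ≤ ι 0 • √E₀`; (R1η) for EVERY admissible nonnegative `(M, D)` and every `c` bounding all finite
partial sums of `Σ_j M i j x m j + Σ_{k<m} Σ_j D (k+1) i j x (m-k-1) j`: `x (m+1) i ≤ (1+η) c + ι (m+1) i √E₀`; (R2′) for every `c` bounding all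
finite partial sums of `Σ_{k≤n} Σ_i Pd k i x (n-k) i`: `√Et ≤ B c + cR n √E₀`. -/
def GenBook (Adm : (Idx → Idx → ℝ) → (ℕ → Idx → Idx → ℝ) → Prop) (η B : ℝ) (ι : ℕ → Idx → ℝ) (Pd : ℕ → Idx → ℝ)
    (cR : ℕ → ℝ) (n : ℕ) (E₀ Et : ℝ) : Prop :=
  ∃ x : ℕ → Idx → ℝ, (∀ m i, 0 ≤ x m i) ∧ (∀ i, x 0 i ≤ ι 0 i * Real.sqrt E₀) ∧
    (∀ (M : Idx → Idx → ℝ) (D : ℕ → Idx → Idx → ℝ), (∀ i j, 0 ≤ M i j) → (∀ k i j, 0 ≤ D k i j) → Adm M D →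
      ∀ (m : ℕ) (i : Idx) (c : ℝ),
        (∀ S : Finset Idx, (∑ j ∈ S, M i j * x m j) +
            (∑ k ∈ Finset.range m, ∑ j ∈ S, D (k + 1) i j * x (m - (k + 1)) j) ≤ c) →
        x (m + 1) i ≤ (1 + η) * c + ι (m + 1) i * Real.sqrt E₀) ∧
    (∀ c : ℝ, (∀ S : Finset Idx, (∑ k ∈ Finset.range (n + 1), ∑ i ∈ S, Pd k i * x (n - k) i) ≤ c) →
      Real.sqrt Et ≤ B * c + cR n * Real.sqrt E₀)

/-- **CONE WITH PROFILE DATA** (S3 as the reshaped assembly consumes it): positive profile `ε`, admissible nonnegative `(M, D)`, p4's renewal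
cone clause verbatim, and the profile costs of the comb feed `ι`, the debris read-out weights `Pd ≥ 0` and the comb remnant read-out `cR`. -/
def ConeP (Adm : (Idx → Idx → ℝ) → (ℕ → Idx → Idx → ℝ) → Prop) (ρ : ℝ) (ι : ℕ → Idx → ℝ) (Pd : ℕ → Idx → ℝ) (cR : ℕ → ℝ)
    (Γ Cc : ℝ) : Prop :=
  ∃ ε : Idx → ℝ, (∀ i, 0 < ε i) ∧
    ∃ (M : Idx → Idx → ℝ) (D : ℕ → Idx → Idx → ℝ), (∀ i j, 0 ≤ M i j) ∧ (∀ k i j, 0 ≤ D k i j) ∧ Adm M D ∧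
      (∀ (S : Finset Idx) (n : ℕ) (i : Idx),
        (∑ j ∈ S, M i j * ε j) + (∑ k ∈ Finset.range n, (ρ ^ (k + 1))⁻¹ * ∑ j ∈ S, D (k + 1) i j * ε j) ≤ ρ * ε i) ∧
      ∃ κ ϖ : ℕ → ℝ, (∀ m, 0 ≤ κ m) ∧ (∀ m i, ι m i ≤ κ m * ε i) ∧ (∀ k i, 0 ≤ Pd k i) ∧
        (∀ (k : ℕ) (S : Finset Idx), (∑ i ∈ S, Pd k i * ε i) ≤ ϖ k) ∧
        (∀ n : ℕ, (∑ m ∈ Finset.range (n + 1), κ m * (ρ ^ m)⁻¹) * (∑ k ∈ Finset.range (n + 1), ϖ k * (ρ ^ k)⁻¹) ≤ Γ) ∧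
        (∀ n : ℕ, 0 ≤ cR n ∧ cR n ≤ Cc * ρ ^ n)

/-- **BUDGET**: one cap factor per transfer phase INCLUDING the slack, `(1+η)ρ ≤ 5e^{8σ⋆}`, and the two spare cap factors pay the read-out ×
the discounted profile costs plus the comb remnant: `B Γ + Cc ≤ (5e^{8σ⋆})²`. -/
def BudgetP (ρ η B Γ Cc : ℝ) : Prop :=
  0 < ρ ∧ 0 ≤ η ∧ 0 ≤ B ∧ 0 ≤ Cc ∧ (1 + η) * ρ ≤ 5 * Real.exp (sawSigmaStar * 8) ∧
    B * Γ + Cc ≤ (5 * Real.exp (sawSigmaStar * 8)) ^ 2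

/-- Discounting lemma: `r^(m-k) ≤ r^m (ρ^k)⁻¹` for `0 < ρ ≤ r`, `k ≤ m`. -/
private theorem pow_sub_le_mul_inv {ρ r : ℝ} (hρ : 0 < ρ) (hρr : ρ ≤ r) {m k : ℕ} (hk : k ≤ m) :
    r ^ (m - k) ≤ r ^ m * (ρ ^ k)⁻¹ := by
  have hr : 0 < r := hρ.trans_le hρr
  have h1 : r ^ m = r ^ (m - k) * r ^ k := by rw [← pow_add, Nat.sub_add_cancel hk]
  rw [h1, mul_assoc]
  have h2 : 1 ≤ r ^ k * (ρ ^ k)⁻¹ := by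
    rw [← div_eq_mul_inv, one_le_div (pow_pos hρ k)]
    exact pow_le_pow_left₀ hρ.le hρr k
  calc r ^ (m - k) = r ^ (m - k) * 1 := (mul_one _).symm
    _ ≤ r ^ (m - k) * (r ^ k * (ρ ^ k)⁻¹) := mul_le_mul_of_nonneg_left h2 (pow_nonneg hr.le _)

/-- **THE ALGEBRAIC CORE OF THE RESHAPED ASSEMBLY.**  Bookkeeping + cone with profile data + budget ⇒ the read-out at phase `j₀+1+n` is under
`n+2` cap factors: `Et ≤ (5e^{8σ⋆})^{2(n+2)} E₀`.  Proof: with `r = (1+η)ρ` and `G m = √E₀ Σ_{l≤m} κ l r^{-l}` (nondecreasing), strong induction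
gives `x m i ≤ r^m G m ε i` (the cone row inequality bounds every partial sum in (R1η) by `r^m G m ρ ε i`, older generations being discounted by
`r^(m-k-1) ≤ r^m ρ^{-(k+1)}`); then (R2′) with `c = r^n G n Σ_{k≤n} ϖ k ρ^{-k}` and `G n ≤ √E₀ Σ κ ρ^{-l}`, `cR n ≤ Cc ρ^n ≤ Cc r^n`. -/
theorem GenBook.readout_le {Adm : (Idx → Idx → ℝ) → (ℕ → Idx → Idx → ℝ) → Prop} {η B ρ Γ Cc E₀ Et : ℝ}
    {ι : ℕ → Idx → ℝ} {Pd : ℕ → Idx → ℝ} {cR : ℕ → ℝ} {n : ℕ}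
    (hGB : GenBook Adm η B ι Pd cR n E₀ Et) (hC : ConeP Adm ρ ι Pd cR Γ Cc) (hb : BudgetP ρ η B Γ Cc)
    (hE₀ : 0 ≤ E₀) (hEt : 0 ≤ Et) :
    Et ≤ (5 * Real.exp (sawSigmaStar * 8)) ^ (2 * (n + 2)) * E₀ := by
  obtain ⟨x, hxnn, hx0, hstep, hread⟩ := hGB
  obtain ⟨ε, hε, M, D, hM, hD, hAdm, hcone, κ, ϖ, hκ, hικ, hPd, hϖ, hΓ, hcR⟩ := hC
  obtain ⟨hρ, hη, hB, hCc, hrL, hBL⟩ := hb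
  set L : ℝ := 5 * Real.exp (sawSigmaStar * 8) with hL
  set r : ℝ := (1 + η) * ρ with hr
  have hη1 : 1 ≤ 1 + η := by linarith
  have hρr : ρ ≤ r := by rw [hr]; nlinarith
  have hr0 : 0 < r := hρ.trans_le hρr
  have hsq0 : 0 ≤ Real.sqrt E₀ := Real.sqrt_nonneg _
  -- the gauge sequence
  set G : ℕ → ℝ := fun m => Real.sqrt E₀ * ∑ l ∈ Finset.range (m + 1), κ l * (r ^ l)⁻¹ with hG
  have hGterm : ∀ l, 0 ≤ κ l * (r ^ l)⁻¹ := fun l => mul_nonneg (hκ l) (inv_nonneg.mpr (pow_nonneg hr0.le l))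
  have hG0 : ∀ m, 0 ≤ G m := fun m => mul_nonneg hsq0 (Finset.sum_nonneg fun l _ => hGterm l)
  have hGmono : ∀ {l m : ℕ}, l ≤ m → G l ≤ G m := by
    intro l m hlm
    simp only [hG]
    refine mul_le_mul_of_nonneg_left ?_ hsq0
    exact Finset.sum_le_sum_of_subset_of_nonneg (Finset.range_mono (by omega)) fun i _ _ => hGterm i
  have hGsucc : ∀ m, G (m + 1) = G m + Real.sqrt E₀ * (κ (m + 1) * (r ^ (m + 1))⁻¹) := by
    intro m; simp only [hG]; rw [Finset.sum_range_succ, mul_add]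
  -- the envelope, by strong induction
  have henv : ∀ m, ∀ l, l ≤ m → ∀ i, x l i ≤ r ^ l * G l * ε i := by
    intro m
    induction m with
    | zero =>
      intro l hl i
      have hl0 : l = 0 := by omega
      subst hl0
      calc x 0 i ≤ ι 0 i * Real.sqrt E₀ := hx0 i
        _ ≤ (κ 0 * ε i) * Real.sqrt E₀ := mul_le_mul_of_nonneg_right (hικ 0 i) hsq0
        _ = r ^ 0 * G 0 * ε i := by simp only [hG]; simp; ring
    | succ m ih =>
      intro l hl i
      rcases Nat.lt_or_ge l (m + 1) with hlt | hge
      · exact ih l (by omega) i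
      · have hl : l = m + 1 := by omega
        subst hl
        -- bound every partial sum of (R1η) at generation m by `r^m G m ρ ε i`
        have hpart : ∀ S : Finset Idx, (∑ j ∈ S, M i j * x m j) +
            (∑ k ∈ Finset.range m, ∑ j ∈ S, D (k + 1) i j * x (m - (k + 1)) j) ≤ r ^ m * G m * (ρ * ε i) := by
          intro S
          have h1 : (∑ j ∈ S, M i j * x m j) ≤ ∑ j ∈ S, M i j * (r ^ m * G m * ε j) :=
            Finset.sum_le_sum fun j _ => mul_le_mul_of_nonneg_left (ih m le_rfl j) (hM i j)
          have h2 : (∑ k ∈ Finset.range m, ∑ j ∈ S, D (k + 1) i j * x (m - (k + 1)) j) ≤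
              ∑ k ∈ Finset.range m, ∑ j ∈ S, D (k + 1) i j * (r ^ m * G m * ((ρ ^ (k + 1))⁻¹ * ε j)) := by
            refine Finset.sum_le_sum fun k hk => Finset.sum_le_sum fun j _ => mul_le_mul_of_nonneg_left ?_ (hD _ i j)
            have hkm : k + 1 ≤ m := by simpa [Finset.mem_range] using hk
            calc x (m - (k + 1)) j ≤ r ^ (m - (k + 1)) * G (m - (k + 1)) * ε j := ih (m - (k + 1)) (by omega) j
              _ ≤ (r ^ m * (ρ ^ (k + 1))⁻¹) * G m * ε j :=
                  mul_le_mul_of_nonneg_right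
                    (mul_le_mul (pow_sub_le_mul_inv hρ hρr hkm) (hGmono (by omega)) (hG0 _)
                      (mul_nonneg (pow_nonneg hr0.le _) (inv_nonneg.mpr (pow_nonneg hρ.le _))))
                    (hε j).le
              _ = r ^ m * G m * ((ρ ^ (k + 1))⁻¹ * ε j) := by ring
          have h3 : (∑ j ∈ S, M i j * (r ^ m * G m * ε j)) +
              (∑ k ∈ Finset.range m, ∑ j ∈ S, D (k + 1) i j * (r ^ m * G m * ((ρ ^ (k + 1))⁻¹ * ε j))) =
              r ^ m * G m * ((∑ j ∈ S, M i j * ε j) +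
                ∑ k ∈ Finset.range m, (ρ ^ (k + 1))⁻¹ * ∑ j ∈ S, D (k + 1) i j * ε j) := by
            rw [mul_add, Finset.mul_sum, Finset.mul_sum]
            congr 1
            · exact Finset.sum_congr rfl fun j _ => by ring
            · refine Finset.sum_congr rfl fun k _ => ?_
              rw [Finset.mul_sum, Finset.mul_sum]
              exact Finset.sum_congr rfl fun j _ => by ring
          calc _ ≤ _ := add_le_add h1 h2
            _ = _ := h3
            _ ≤ r ^ m * G m * (ρ * ε i) :=
                mul_le_mul_of_nonneg_left (hcone S m i) (mul_nonneg (pow_nonneg hr0.le _) (hG0 _))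
        have hx1 := hstep M D hM hD hAdm m i (r ^ m * G m * (ρ * ε i)) hpart
        calc x (m + 1) i ≤ (1 + η) * (r ^ m * G m * (ρ * ε i)) + ι (m + 1) i * Real.sqrt E₀ := hx1
          _ ≤ (1 + η) * (r ^ m * G m * (ρ * ε i)) + (κ (m + 1) * ε i) * Real.sqrt E₀ :=
              add_le_add le_rfl (mul_le_mul_of_nonneg_right (hικ _ i) hsq0)
          _ = r ^ (m + 1) * G (m + 1) * ε i := by
              rw [hGsucc m]
              have h1 : r ^ (m + 1) * (r ^ (m + 1))⁻¹ = 1 := mul_inv_cancel₀ (pow_ne_zero _ hr0.ne')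
              have h2 : (1 + η) * (r ^ m * G m * (ρ * ε i)) = r ^ (m + 1) * G m * ε i := by
                rw [pow_succ, hr]; ring
              rw [h2]
              calc r ^ (m + 1) * G m * ε i + κ (m + 1) * ε i * Real.sqrt E₀
                  = r ^ (m + 1) * G m * ε i + (r ^ (m + 1) * (r ^ (m + 1))⁻¹) * (κ (m + 1) * ε i * Real.sqrt E₀) := by
                    rw [h1, one_mul]
                _ = r ^ (m + 1) * (G m + Real.sqrt E₀ * (κ (m + 1) * (r ^ (m + 1))⁻¹)) * ε i := by ring
  have henv' : ∀ l i, x l i ≤ r ^ l * G l * ε i := fun l i => henv l l le_rfl i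
  -- the read-out
  set W : ℝ := ∑ k ∈ Finset.range (n + 1), ϖ k * (ρ ^ k)⁻¹ with hW
  have hpart2 : ∀ S : Finset Idx, (∑ k ∈ Finset.range (n + 1), ∑ i ∈ S, Pd k i * x (n - k) i) ≤ r ^ n * G n * W := by
    intro S
    calc (∑ k ∈ Finset.range (n + 1), ∑ i ∈ S, Pd k i * x (n - k) i)
        ≤ ∑ k ∈ Finset.range (n + 1), ∑ i ∈ S, Pd k i * (r ^ n * G n * ((ρ ^ k)⁻¹ * ε i)) := by
          refine Finset.sum_le_sum fun k hk => Finset.sum_le_sum fun i _ => mul_le_mul_of_nonneg_left ?_ (hPd k i)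
          have hkn : k ≤ n := by simpa [Finset.mem_range, Nat.lt_succ_iff] using hk
          calc x (n - k) i ≤ r ^ (n - k) * G (n - k) * ε i := henv' _ i
            _ ≤ (r ^ n * (ρ ^ k)⁻¹) * G n * ε i :=
                mul_le_mul_of_nonneg_right
                  (mul_le_mul (pow_sub_le_mul_inv hρ hρr hkn) (hGmono (by omega)) (hG0 _)
                    (mul_nonneg (pow_nonneg hr0.le _) (inv_nonneg.mpr (pow_nonneg hρ.le _))))
                  (hε i).le
            _ = r ^ n * G n * ((ρ ^ k)⁻¹ * ε i) := by ring
      _ = r ^ n * G n * ∑ k ∈ Finset.range (n + 1), (ρ ^ k)⁻¹ * ∑ i ∈ S, Pd k i * ε i := by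
          rw [Finset.mul_sum]
          refine Finset.sum_congr rfl fun k _ => ?_
          rw [Finset.mul_sum, Finset.mul_sum]
          exact Finset.sum_congr rfl fun i _ => by ring
      _ ≤ r ^ n * G n * W := by
          refine mul_le_mul_of_nonneg_left ?_ (mul_nonneg (pow_nonneg hr0.le _) (hG0 _))
          rw [hW]
          refine Finset.sum_le_sum fun k _ => ?_
          rw [mul_comm (ϖ k)]
          exact mul_le_mul_of_nonneg_left (hϖ k S) (inv_nonneg.mpr (pow_nonneg hρ.le _))
  have hread' := hread (r ^ n * G n * W) hpart2
  -- `G n ≤ √E₀ Σ κ ρ^{-l}` and the product bound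
  have hGn : G n ≤ Real.sqrt E₀ * ∑ l ∈ Finset.range (n + 1), κ l * (ρ ^ l)⁻¹ := by
    simp only [hG]
    refine mul_le_mul_of_nonneg_left (Finset.sum_le_sum fun l _ => mul_le_mul_of_nonneg_left ?_ (hκ l)) hsq0
    exact inv_anti₀ (pow_pos hρ l) (pow_le_pow_left₀ hρ.le hρr l)
  have hprod : G n * W ≤ Real.sqrt E₀ * Γ := by
    have hW0 : 0 ≤ W := by
      rw [hW]
      refine Finset.sum_nonneg fun k _ => mul_nonneg ?_ (inv_nonneg.mpr (pow_nonneg hρ.le _))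
      exact le_trans (Finset.sum_nonneg fun i _ => mul_nonneg (hPd k i) (hε i).le) (hϖ k ∅) |>.trans' (by simp)
    calc G n * W ≤ (Real.sqrt E₀ * ∑ l ∈ Finset.range (n + 1), κ l * (ρ ^ l)⁻¹) * W :=
          mul_le_mul_of_nonneg_right hGn hW0
      _ = Real.sqrt E₀ * ((∑ l ∈ Finset.range (n + 1), κ l * (ρ ^ l)⁻¹) * W) := by ring
      _ ≤ Real.sqrt E₀ * Γ := mul_le_mul_of_nonneg_left (by rw [hW]; exact hΓ n) hsq0
  have hrn : r ^ n ≤ L ^ n := pow_le_pow_left₀ hr0.le (by rw [hr, hL]; exact hrL) n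
  have hρn : ρ ^ n ≤ r ^ n := pow_le_pow_left₀ hρ.le hρr n
  have hL0 : 0 ≤ L := by rw [hL]; positivity
  have key : Real.sqrt Et ≤ Real.sqrt E₀ * L ^ (n + 2) := by
    calc Real.sqrt Et ≤ B * (r ^ n * G n * W) + cR n * Real.sqrt E₀ := hread'
      _ = r ^ n * (B * (G n * W)) + cR n * Real.sqrt E₀ := by ring
      _ ≤ r ^ n * (B * (Real.sqrt E₀ * Γ)) + (Cc * ρ ^ n) * Real.sqrt E₀ :=
          add_le_add (mul_le_mul_of_nonneg_left (mul_le_mul_of_nonneg_left hprod hB) (pow_nonneg hr0.le _))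
            (mul_le_mul_of_nonneg_right (hcR n).2 hsq0)
      _ ≤ r ^ n * (B * (Real.sqrt E₀ * Γ)) + (Cc * r ^ n) * Real.sqrt E₀ :=
          add_le_add le_rfl (mul_le_mul_of_nonneg_right (mul_le_mul_of_nonneg_left hρn hCc) hsq0)
      _ = Real.sqrt E₀ * (B * Γ + Cc) * r ^ n := by ring
      _ ≤ Real.sqrt E₀ * L ^ 2 * L ^ n :=
          mul_le_mul (mul_le_mul_of_nonneg_left hBL hsq0) hrn (pow_nonneg hr0.le n)
            (mul_nonneg hsq0 (pow_nonneg hL0 2))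
      _ = Real.sqrt E₀ * L ^ (n + 2) := by ring
  have hsq : Et ≤ E₀ * (L ^ (n + 2)) ^ 2 := by
    have hh := pow_le_pow_left₀ (Real.sqrt_nonneg _) key 2
    rwa [Real.sq_sqrt hEt, mul_pow, Real.sq_sqrt hE₀] at hh
  calc Et ≤ E₀ * (L ^ (n + 2)) ^ 2 := hsq
    _ = L ^ (2 * (n + 2)) * E₀ := by rw [← pow_mul, mul_comm (n + 2) 2]; ring

end Algebra

/-! ## 2. The reshaped material representation and the assembly -/

/-- The two piece types carrying a shell profile (as in `K2ConeSketch.lean` §4). -/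
inductive PType
  | V
  | H
  deriving DecidableEq, Fintype

/-- The bookkeeping index: (piece type, shell). -/
abbrev Idx : Type := PType × ℕ

/-- **WEAKEST K2 AT THE K1loc′ POINT** — route-2's crux of record (SHAPE Q v2 text verbatim, as in `K2AssemblyS4.lean` §1). -/
def K2GrowthCtgPointH : Prop :=
  ∃ δ₀ ∈ Set.Ioc (0 : ℝ) ((2 : ℝ)⁻¹ ^ 100), K2PhaseGrowthClassicalH ⟨8, δ₀, 2, 1, 2⟩ 5

/-- **MATERIAL REPRESENTATION AT `P`, RESHAPED (`MatRepAt′`).**  PDE binders VERBATIM as in v3 (`K2PhaseGrowthClassicalH`'s class, phases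
`j₀ < J < Jrate (γ²−3) ν + A`); the conclusion at each `t` of phase `J`'s window is the abstract bookkeeping predicate `GenBook` at generation
`n = J − j₀ − 1` with input energy `‖w₀‖²` and current energy `‖w(t)‖²`.  `Adm` = the admissibility predicate of entry families (v4: the
window-corrected `EntryBoundsW 8 K₀`); `η` = per-phase slack; `ι` = comb-lineage creation profile by age (`ι 0` = injection); `Pd` = debris
read-out weights by age; `cR` = comb remnant read-out by age. -/
def MatRepAt' (P : CascadeParams) (Adm : (Idx → Idx → ℝ) → (ℕ → Idx → Idx → ℝ) → Prop) (η B : ℝ) (ι : ℕ → Idx → ℝ)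
    (Pd : ℕ → Idx → ℝ) (cR : ℕ → ℝ) : Prop :=
  ∀ A : ℕ, ∃ ν₀ : ℝ, 0 < ν₀ ∧ ∀ ν ∈ Set.Ioc 0 ν₀, ∀ (j₀ J : ℕ), j₀ < J → J < Jrate (P.γ ^ 2 - 3) ν + A → ∀ (hz : Bool)
    (w₀ : UnitAddTorus (Fin 2) → EuclideanSpace ℝ (Fin 2))
    (w : ℝ → UnitAddTorus (Fin 2) → EuclideanSpace ℝ (Fin 2)) (q : ℝ → UnitAddTorus (Fin 2) → ℝ),
    ShearCombDatum (P.N j₀) hz w₀ →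
    Torus.IsSmoothSpaceTimeOn (Set.Icc (CascadeParams.tInject j₀ hz) (CascadeParams.tStart (J + 1))) w →
    Torus.IsSmoothSpaceTimeOn (Set.Icc (CascadeParams.tInject j₀ hz) (CascadeParams.tStart (J + 1))) q →
    (∀ t ∈ Set.Icc (CascadeParams.tInject j₀ hz) (CascadeParams.tStart (J + 1)), Torus.IsDivFree (w t)) →
    (∀ t ∈ Set.Icc (CascadeParams.tInject j₀ hz) (CascadeParams.tStart (J + 1)), ∀ x,
      Torus.timeDerivWithin (Set.Icc (CascadeParams.tInject j₀ hz) (CascadeParams.tStart (J + 1))) w t x +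
        Torus.convect (P.field t) (w t) x + Torus.convect (w t) (P.field t) x =
        ν • Torus.laplacian (w t) x - Torus.gradient (q t) x) →
    w (CascadeParams.tInject j₀ hz) = w₀ →
    ∀ t ∈ Set.Icc (max (CascadeParams.tInject j₀ hz) (CascadeParams.tStart J)) (CascadeParams.tStart (J + 1)),
      GenBook Adm η B ι Pd cR (J - j₀ - 1) (Torus.vectorL2Sq w₀) (Torus.vectorL2Sq (w t))

/-- `MatRepAt′` at SOME corner rounding `δ₀ ∈ (0, 2⁻¹⁰⁰]` of the design point (the `∃ δ₀` of the crux); `Adm` may depend on nothing else. -/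
def MaterialRepresentation' (Adm : (Idx → Idx → ℝ) → (ℕ → Idx → Idx → ℝ) → Prop) (η B : ℝ) (ι : ℕ → Idx → ℝ)
    (Pd : ℕ → Idx → ℝ) (cR : ℕ → ℝ) : Prop :=
  ∃ δ₀ ∈ Set.Ioc (0 : ℝ) ((2 : ℝ)⁻¹ ^ 100), MatRepAt' ⟨8, δ₀, 2, 1, 2⟩ Adm η B ι Pd cR

private theorem vectorL2Sq_nonneg (v : UnitAddTorus (Fin 2) → EuclideanSpace ℝ (Fin 2)) : 0 ≤ Torus.vectorL2Sq v := by
  unfold Torus.vectorL2Sq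
  exact MeasureTheory.integral_nonneg fun _ => by positivity

/-- **S3′ + S-2′ + budget ⇒ the horizon cap 5 at `P`** (`P.γ = 8`, `P.δ₀ > 0`, `P.d > 0`): `J = j₀` is the landed `k2_injectionPhase_cap5`
(every `ν > 0`); `J > j₀` is `GenBook.readout_le`. -/
theorem k2PhaseGrowthClassicalH_of_matRep' (P : CascadeParams) (hγ : P.γ = 8) (hδ₀ : 0 < P.δ₀) (hd : 0 < P.d)
    {Adm : (Idx → Idx → ℝ) → (ℕ → Idx → Idx → ℝ) → Prop} {ρ η B Γ Cc : ℝ} {ι : ℕ → Idx → ℝ} {Pd : ℕ → Idx → ℝ} {cR : ℕ → ℝ}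
    (h3 : ConeP Adm ρ ι Pd cR Γ Cc) (h2 : MatRepAt' P Adm η B ι Pd cR) (hb : BudgetP ρ η B Γ Cc) :
    K2PhaseGrowthClassicalH P 5 := by
  intro A
  obtain ⟨ν₀, hν₀, H⟩ := h2 A
  refine ⟨ν₀, hν₀, ?_⟩
  intro ν hν j₀ J hj hJ hz w₀ w q hdat hw hq hdiv hlin h0 t ht
  rcases Nat.eq_or_lt_of_le hj with hJj | hlt
  · subst hJj
    exact Summit.AnomalousDissipation.AnomalousDissipation.Theorems.SawtoothPulseCascade.K2Classical.k2_injectionPhase_cap5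
      P (by rw [hγ]; norm_num) (le_of_eq hγ) hδ₀ hd hν.1 j₀ hz w₀ w q hdat hw hq hdiv hlin h0 t ht
  · have hGB := H ν hν j₀ J hlt hJ hz w₀ w q hdat hw hq hdiv hlin h0 t ht
    have hmain := GenBook.readout_le hGB h3 hb (vectorL2Sq_nonneg w₀) (vectorL2Sq_nonneg (w t))
    have hexp : J + 1 - j₀ = (J - j₀ - 1) + 2 := by omega
    rw [hexp, hγ]
    exact hmain

/-- **`K2GrowthCtgPointH_of′` — THE RESHAPED S4 ASSEMBLY.** -/
theorem K2GrowthCtgPointH_of' {Adm : (Idx → Idx → ℝ) → (ℕ → Idx → Idx → ℝ) → Prop} {ρ η B Γ Cc : ℝ}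
    {ι : ℕ → Idx → ℝ} {Pd : ℕ → Idx → ℝ} {cR : ℕ → ℝ}
    (h3 : ConeP Adm ρ ι Pd cR Γ Cc) (h2 : MaterialRepresentation' Adm η B ι Pd cR) (hb : BudgetP ρ η B Γ Cc) :
    K2GrowthCtgPointH := by
  obtain ⟨δ₀, hδ₀, hrep⟩ := h2
  exact ⟨δ₀, hδ₀, k2PhaseGrowthClassicalH_of_matRep' ⟨8, δ₀, 2, 1, 2⟩ rfl hδ₀.1 (by norm_num) h3 hrep hb⟩

/-- … and hence route-2's `Target` (via `target_of_K2GrowthCtgPointH`, p670365). -/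
theorem target_of_S4' {Adm : (Idx → Idx → ℝ) → (ℕ → Idx → Idx → ℝ) → Prop} {ρ η B Γ Cc : ℝ}
    {ι : ℕ → Idx → ℝ} {Pd : ℕ → Idx → ℝ} {cR : ℕ → ℝ}
    (h3 : ConeP Adm ρ ι Pd cR Γ Cc) (h2 : MaterialRepresentation' Adm η B ι Pd cR) (hb : BudgetP ρ η B Γ Cc) :
    Summit.AnomalousDissipation.AnomalousDissipation.Theses.SawtoothPulseCascade.Target :=
  Summit.AnomalousDissipation.AnomalousDissipation.Theorems.SawtoothPulseCascade.target_of_K2GrowthCtgPointH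
    (K2GrowthCtgPointH_of' h3 h2 hb)

end Summit.AnomalousDissipation.AnomalousDissipation.Cruxes.K1LocalisedCascade.K2S4Vet
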